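import Literature.Topology.FourManifolds.BoundaryGluingConstruction
import Literature.Topology.FourManifolds.GluedMetric
import Literature.Geometry.Manifold.SmoothEmbeddingInverse
import HarnessLib

/-!
# The seam tube of the three-piece gluing `M ∪_φ N` and the involution `τ × id` on it

Support file (everything proved, no definitions, no named facts) for the τ-equivariant collar
gluing (stub `stub_collarGluing` of crux `CorkRegluablePsc`, item stmt-SmoothPoincare4-3206),
complementing `BoundaryGluingConstruction.lean` (Milnor 1965, proof of Thm. 1.4;
Bröcker–Jänich 1982, (13.8), (13.11); Hirsch 1976, Ch. 8 §2): for the gluing datum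
`G = (CM, CN, φ)` the glued manifold `P = G.d₂.Glued` contains the **seam tube**
`∂M × ℝ ↪ P`, `p ↦ inl (inl p)`, an open smooth embedding (`isSmoothEmbedding_inl_inl`) whose
points with `t ≥ 0` are exactly those of the piece `jM(M)` (`inl_inl_mem_range_jM_iff`), whose
points with `t > 0` / `t < 0` are interior points of `M` / `N` (`inl_inl_eq_inl_inr`,
`inl_inl_eq_inr_inPt`), and every point of `P` lies in the tube or in one of the two interiors
(`exists_tube_or_interior`).  For an involutive diffeomorphism `τ` of `∂M` the map `τ × id` of
the tube extends (by the identity) to a map `T : P → P` which is smooth, involutive and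
side-preserving on the tube and restricts to `τ` on the seam `jM(∂M)`
(`exists_seamInvolution`); the differentials of the tube and of the interior pieces are
bijective / injective (`bijective_mfderiv_inl_inl`, `injective_mfderiv_inl_inr`).

## References

* J. Milnor, *Lectures on the h-cobordism theorem* (1965), §1, Thm. 1.4. [MilnorHCobordism1965]
* T. Bröcker, K. Jänich, *Introduction to Differential Topology* (1982), (13.8), (13.11).
  [BrockerJanich1982]
* M. W. Hirsch, *Differential Topology* (1976), Ch. 8 §2. [Hirsch1976]
-/

open scoped Manifold ContDiff Topology
open Set Function Topology

noncomputable section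

namespace Literature.Topology.FourManifolds

universe u

/-- Local notation: `𝔼 n` is the model Euclidean space `EuclideanSpace ℝ (Fin n)`. -/
local notation "𝔼 " n:arg => EuclideanSpace ℝ (Fin n)
/-- Local notation: `ℍ n` is the model half-space `EuclideanHalfSpace n`. -/
local notation "ℍ " n:arg => EuclideanHalfSpace n

namespace BoundaryGlueData

variable {n : ℕ} {M N : Type u}
  [TopologicalSpace M] [ChartedSpace (ℍ (n + 1)) M] [TopologicalSpace N] [ChartedSpace (ℍ (n + 1)) N]
  {bM : BoundaryData (𝓡∂ (n + 1)) M (𝓡 n)} {bN : BoundaryData (𝓡∂ (n + 1)) N (𝓡 n)}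
  (G : BoundaryGlueData bM bN) [IsManifold (𝓡∂ (n + 1)) ∞ M] [Nonempty bM.carrier]
  [IsManifold (𝓡∂ (n + 1)) ∞ N]

/-! ### The seam tube `∂M × ℝ ↪ P` -/

/-- **The seam tube is an open embedding** `∂M × ℝ → P`, `p ↦ inl (inl p)`. [folklore] -/
theorem isOpenEmbedding_inl_inl : IsOpenEmbedding (G.d₂.inl ∘ G.d₁.inl) :=
  G.d₂.isOpenEmbedding_inl.comp G.d₁.isOpenEmbedding_inl

/-- The seam tube is a smooth embedding. [folklore] -/
theorem isSmoothEmbedding_inl_inl :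
    Manifold.IsSmoothEmbedding ((𝓡 n).prod 𝓘(ℝ, ℝ)) 𝓘(ℝ, 𝔼 (n + 1)) ∞ (G.d₂.inl ∘ G.d₁.inl) :=
  G.d₂.isSmoothEmbedding_inl_comp G.d₁.isSmoothEmbedding_inl

/-- The seam tube is smooth. [folklore] -/
theorem contMDiff_inl_inl :
    ContMDiff ((𝓡 n).prod 𝓘(ℝ, ℝ)) 𝓘(ℝ, 𝔼 (n + 1)) ∞ (G.d₂.inl ∘ G.d₁.inl) :=
  G.d₂.contMDiff_inl.comp G.d₁.contMDiff_inl

/-- The seam tube has open range. [folklore] -/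
theorem isOpen_range_inl_inl : IsOpen (range (G.d₂.inl ∘ G.d₁.inl)) :=
  G.isOpenEmbedding_inl_inl.isOpen_range

/-- The seam tube is injective. [folklore] -/
theorem injective_inl_inl : Injective (G.d₂.inl ∘ G.d₁.inl) :=
  G.d₂.inl_injective.comp G.d₁.inl_injective

/-- **A tube point with `t > 0` is an interior point of `M`**: `inl (inl p) = inl (inr (CM p))`
(first gluing relation). [folklore] -/
theorem inl_inl_eq_inl_inr {p : bM.carrier × ℝ} (hp : 0 < p.2) :
    G.d₂.inl (G.d₁.inl p) = G.d₂.inl (G.d₁.inr (G.CM.inPt p)) :=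
  congrArg G.d₂.inl (G.d₁.inr_glue (show p ∈ G.d₁.glue.source from hp)).symm

/-- **A tube point with `t < 0` is an interior point of `N`**: `inl (inl p) = inr (CN (φ p₁, -p₂))`
(second gluing relation). [folklore] -/
theorem inl_inl_eq_inr_inPt {p : bM.carrier × ℝ} (hp : p.2 < 0) :
    G.d₂.inl (G.d₁.inl p) = G.d₂.inr (G.CN.inPt (G.φ p.1, -p.2)) := by
  rw [← G.glue₂_inl p]
  exact (G.d₂.inr_glue (G.inl_mem_glue₂_source_iff.2 hp)).symm

/-- **The tube points of the piece `jM(M)` are exactly those with `t ≥ 0`.** [folklore] -/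
theorem inl_inl_mem_range_jM_iff {p : bM.carrier × ℝ} :
    G.d₂.inl (G.d₁.inl p) ∈ range G.jM ↔ 0 ≤ p.2 := by
  constructor
  · rintro ⟨a, ha⟩
    by_contra h
    have h : p.2 < 0 := lt_of_not_ge h
    have hs : 0 ≤ -p.2 := by linarith
    have h1 : G.jN (G.CN.toFun (G.φ p.1) (-p.2)) = G.d₂.inl (G.d₁.inl p) := by
      rw [G.jN_toFun p.1 hs, neg_neg]
    obtain ⟨z, -, hz⟩ := G.jM_eq_jN_iff.1 (ha.trans h1.symm)
    have hint : (𝓡∂ (n + 1)).IsInteriorPoint (G.CN.toFun (G.φ p.1) (-p.2)) :=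
      G.CN.isInteriorPoint_apply _ (by linarith)
    rw [hz] at hint
    exact ((𝓡∂ (n + 1)).isInteriorPoint_iff_not_isBoundaryPoint _).1 hint
      (bN.incl_mem_boundary (G.φ z))
  · intro hp
    exact ⟨G.CM.toFun p.1 p.2, G.jM_toFun p.1 hp⟩

/-- The seam `jM(∂M)` lies in the tube: `jM (incl z) = inl (inl (z, 0))`. [folklore] -/
theorem jM_incl_mem_range_inl_inl (z : bM.carrier) :
    G.jM (bM.incl z) ∈ range (G.d₂.inl ∘ G.d₁.inl) :=
  ⟨(z, 0), (G.jM_incl z).symm⟩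

/-- **Every point of `P` lies in the tube, in the interior of `M` or in the interior of `N`.**
[folklore] -/
theorem exists_tube_or_interior (x : G.d₂.Glued) :
    (∃ p, x = G.d₂.inl (G.d₁.inl p)) ∨ (∃ a, x = G.d₂.inl (G.d₁.inr a)) ∨ ∃ b, x = G.d₂.inr b := by
  obtain (⟨y, rfl⟩ | ⟨b, rfl⟩) := G.d₂.exists_inl_or_inr x
  · obtain (⟨p, rfl⟩ | ⟨a, rfl⟩) := G.d₁.exists_inl_or_inr y
    · exact Or.inl ⟨p, rfl⟩
    · exact Or.inr (Or.inl ⟨a, rfl⟩)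
  · exact Or.inr (Or.inr ⟨b, rfl⟩)

/-! ### Differentials of the pieces -/

/-- **The differential of the seam tube is bijective.** [folklore] -/
theorem bijective_mfderiv_inl_inl (p : bM.carrier × ℝ) :
    Bijective (mfderiv ((𝓡 n).prod 𝓘(ℝ, ℝ)) 𝓘(ℝ, 𝔼 (n + 1)) (G.d₂.inl ∘ G.d₁.inl) p) := by
  rw [mfderiv_comp p (G.d₂.contMDiff_inl.mdifferentiableAt (by simp))
    (G.d₁.contMDiff_inl.mdifferentiableAt (by simp))]
  exact (G.d₂.mfderiv_inl_bijective _).comp (G.d₁.mfderiv_inl_bijective p)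

/-- **The differential of the interior piece `M - ∂M → P` is injective.** [folklore] -/
theorem injective_mfderiv_inl_inr (a : InteriorManifold (𝓡∂ (n + 1)) M) :
    Injective (mfderiv 𝓘(ℝ, 𝔼 (n + 1)) 𝓘(ℝ, 𝔼 (n + 1)) (G.d₂.inl ∘ G.d₁.inr) a) := by
  rw [mfderiv_comp a (G.d₂.contMDiff_inl.mdifferentiableAt (by simp))
    (G.d₁.contMDiff_inr.mdifferentiableAt (by simp))]
  exact (G.d₂.mfderiv_inl_bijective _).1.comp (G.d₁.mfderiv_inr_bijective a).1

/-! ### The involution `τ × id` of the tube -/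

/-- **The seam involution.** For an involutive diffeomorphism `τ` of `∂M` there is a map
`T : P → P` which on the tube is `inl (inl (z, t)) ↦ inl (inl (τ z, t))` (and the identity off
it); `T` is smooth on the tube, maps it to itself, is involutive there, preserves the side
`jM(M)` (the sign of `t`), and restricts to `τ` on the seam: `T (jM (incl z)) = jM (incl (τ z))`.
[folklore] -/
theorem exists_seamInvolution (τ : bM.carrier ≃ₘ⟮𝓡 n, 𝓡 n⟯ bM.carrier) (hτ : Involutive τ) :
    ∃ T : G.d₂.Glued → G.d₂.Glued,
      (∀ p, T (G.d₂.inl (G.d₁.inl p)) = G.d₂.inl (G.d₁.inl (τ p.1, p.2))) ∧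
      ContMDiffOn 𝓘(ℝ, 𝔼 (n + 1)) 𝓘(ℝ, 𝔼 (n + 1)) ∞ T (range (G.d₂.inl ∘ G.d₁.inl)) ∧
      (∀ x ∈ range (G.d₂.inl ∘ G.d₁.inl), T x ∈ range (G.d₂.inl ∘ G.d₁.inl)) ∧
      (∀ x ∈ range (G.d₂.inl ∘ G.d₁.inl), T (T x) = x) ∧
      (∀ x ∈ range (G.d₂.inl ∘ G.d₁.inl), (T x ∈ range G.jM ↔ x ∈ range G.jM)) ∧
      (∀ z, T (G.jM (bM.incl z)) = G.jM (bM.incl (τ z))) := by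
  classical
  set tube : bM.carrier × ℝ → G.d₂.Glued := G.d₂.inl ∘ G.d₁.inl with htube
  set τ' : bM.carrier × ℝ → bM.carrier × ℝ := Prod.map τ id with hτ'
  have hinj : Injective tube := G.injective_inl_inl
  have hli : LeftInverse (invFun tube) tube := leftInverse_invFun hinj
  set T : G.d₂.Glued → G.d₂.Glued :=
    fun x ↦ if x ∈ range tube then tube (τ' (invFun tube x)) else x with hT
  have hTt : ∀ p, T (tube p) = tube (τ' p) := fun p ↦ by
    simp only [hT, if_pos (mem_range_self (f := tube) p), hli p]
  have hτ'c : ContMDiff ((𝓡 n).prod 𝓘(ℝ, ℝ)) ((𝓡 n).prod 𝓘(ℝ, ℝ)) ∞ τ' :=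
    τ.contMDiff.prodMap contMDiff_id
  refine ⟨T, fun p ↦ hTt p, ?_, ?_, ?_, ?_, fun z ↦ ?_⟩
  · -- smoothness on the tube
    have h1 : ContMDiffOn 𝓘(ℝ, 𝔼 (n + 1)) 𝓘(ℝ, 𝔼 (n + 1)) ∞ (tube ∘ τ' ∘ invFun tube)
        (range tube) :=
      (G.contMDiff_inl_inl.comp hτ'c).comp_contMDiffOn
        (Literature.Geometry.Manifold.contMDiffOn_invFun_range G.isSmoothEmbedding_inl_inl)
    refine h1.congr ?_
    rintro _ ⟨p, rfl⟩
    show T (tube p) = tube (τ' (invFun tube (tube p)))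
    rw [hTt, hli]
  · rintro _ ⟨p, rfl⟩
    show T (tube p) ∈ range tube
    rw [hTt]
    exact mem_range_self _
  · rintro _ ⟨p, rfl⟩
    show T (T (tube p)) = tube p
    rw [hTt, hTt]
    show tube (τ (τ p.1), p.2) = tube p
    rw [hτ p.1]
  · rintro _ ⟨p, rfl⟩
    show T (tube p) ∈ range G.jM ↔ tube p ∈ range G.jM
    rw [hTt]
    show G.d₂.inl (G.d₁.inl (τ p.1, p.2)) ∈ range G.jM ↔ G.d₂.inl (G.d₁.inl p) ∈ range G.jM
    rw [G.inl_inl_mem_range_jM_iff, G.inl_inl_mem_range_jM_iff]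
  · have h1 : G.jM (bM.incl z) = tube (z, 0) := G.jM_incl z
    have h2 : G.jM (bM.incl (τ z)) = tube (τ z, 0) := G.jM_incl (τ z)
    rw [h1, h2, hTt]
    rfl

end BoundaryGlueData

end Literature.Topology.FourManifolds
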